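import Literature.AnabelianGeometry.EtaleTheta.Discharge.Sec5Thm57JunctionGammaDeltaLevelNGalois
import Literature.AnabelianGeometry.EtaleTheta.Discharge.Sec5ThetaSubquotientProjGaloisInhabited

/-!
# [EtTh] §5 p.327: a PINNED v2 subquotient term at the level-`N` data `ofConnectedTemperoidData h (RD.levelStub ιX) …` — and there the
# coverage input `LDeltaCovered` of Prop. 5.5 / Thm. 5.6 (i) / Thm. 5.7 (C) HOLDS for it (proof-only)

Mochizuki, *The étale theta function and its Frobenioid-theoretic manifestations*, Publ. RIMS **45** (2009), §5 p. 327 (PDF p. 101)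
«these subquotients determine subquotients `Aut_D(D) ↠ Aut^Θ_D(D)`; `(l·Δ_Θ)_D ⊆ Aut^Θ_D(D)`»; Prop. 5.5 proof pp. 327–328 (PDF pp. 101–102);
§1 p. 238 (PDF p. 12) (`Δ_Θ` is a quotient of `Π^tp_Ÿ`) [cite: MochizukiEtTh2009, §5 p.327 (PDF p.101)].
abc-iut cell, layer L2, seat abc-iut-w5-d051 (gen 6); S-sized sequel of my row «(w4) V1→V2 PORT — TRANCHE 2 = THM 5.7 (C)-JUNCTION HEADS»
(p486760 / p486982 / p487842).  PROOF-ONLY (0 definitions; nothing landed is edited or restated).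

THE POINT.  Every (Q, P)-binder kit of the Prop. 5.5 / Thm. 5.6 (i) end knits and of the Thm. 5.7 (C)-junction works at abc-iut-L2-t4's genuine
level-`N` data `𝔉_N := ofConnectedTemperoidData h (RD.levelStub ιX) …` (abc-iut-w4-d042's level-`N` stub `RD.levelStub ιX =
thetaSubquotientStub (q_N) (ι_N)`, `q_N` onto) modulo TWO PIN EQUATIONS on the subquotient record `P` at `B_N^bs`:
`hPpre : P.pre B_N^bs = (autPre q_N ι_N B_N^bs.obj).comap (mapAut B_N^bs ι)` and
`hPproj_pin : ∀ σ τ, mapAut σ = τ → P.proj B_N^bs σ = autProj q_N ι_N B_N^bs.obj τ`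
(abc-iut-w4-d042 p448631 / abc-iut-w5-d034 p450400 / abc-iut-L2-t9 p460877, VERBATIM).  On abc-iut-L2-t4's v1 record `ThetaSubquotientProj`
«no `P` TERM is constructed» (VNEXT B1; EMPTY at the root model p476337, at carriers with a rigid object p456572), so the pins stayed
displayed.  abc-iut-w6-d079 exhibited a v2 term `ThetaSubquotientProjGalois 𝔉 (IsGaloisObj ·.obj)` at every level-`N` stub carrier
(`RigidData.nonempty_thetaSubquotientProjGalois_of_stub_eq_levelStub`, p486065 §1 — existence only) and a PINNED v2 term at the junction object
`ofThetaSettingDataQ` (p486065 §2).  THIS FILE does the same AT `𝔉_N`: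
* `exists_thetaSubquotientProjGalois_pinned_levelStub` — a v2 term at `𝔉_N` with `pre F := (autPre q_N ι_N F.obj).comap (mapAut F ι)` and
  `proj F σ := autProj q_N ι_N F.obj ⟨mapAut σ, _⟩` at EVERY object `F` (abc-iut-w6-d079's construction with `(q, ι) := (q_N, ι_N)`; onto at Galois
  objects by `autProj_surjective_at_galoisObj`, `qN_surjective`) — so `hPpre` / `hPproj_pin` hold BY CONSTRUCTION, at `B_N^bs` or anywhere;
* **`exists_thetaSubquotientProjGalois_pinned_lDeltaCoveredGal_levelStub`** — hence, by my `lDeltaCovered_levelStub_of_pins_galois` (p487842; twin of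
  abc-iut-L2-t9's p460877), at `𝔉_N` there is a v2 term (the pinned one) satisfying `hPpre` AND the coverage input `Thm56Sub.LDeltaCoveredGal 𝔉_N P` («the part of
  `H_{B_N}` over `(l·Δ_Θ)_{B_N}` maps ONTO `(l·Δ_Θ)_{B_N} ⊗ ℤ/N`) — with NO further hypothesis: the coverage input of `IsKummerDetermined`-based Prop. 5.5
  (abc-iut-L2-t11's `hcov`), of Thm. 5.6 (i) and of the (C)-junction (`psiAut_symm_eq_of_rigidity_galois`, p486760) is WITNESSED at the K4 end knits'
  carrier on the v2 record;
* `exists_thetaSubquotientProjGalois_pinned_hlift_levelStub` — the same term also satisfies the (C)-junction's hlift law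
  (`hlift_levelStub_of_pin_galois`, p486982) under abc-iut-w4-d042's `hH` («`ιX⁻¹(Stab x) ≤ Π^tp_Ÿ`», a theorem for `A_⊙^bs := Ÿ`).
HONEST FRAMING: statements about the cell's OWN typed records at abc-iut-L2-t4's carrier (`tf`, `RD`, `R`, … abstract data); the OTHER junction
inputs (the Prop. 5.2 (iii) pin, `IsKummerDetermined`, T56-L09c, (K4β), the shadow law) are NOT touched here; nothing asserts that [EtTh]'s data exist
for an actual curve; [EtTh] is refereed; nothing here bears on [IUTchIII] Cor. 3.12 — no side taken; typed ≠ proved; nothing here asserts abc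
proved or refuted.
-/

noncomputable section

namespace Literature.AnabelianGeometry.EtaleTheta

open CategoryTheory Opposite FrobenioidCyclotomicRigidity Literature.AlgebraicGeometry.Frobenioids
  Literature.AnabelianGeometry.SemiGraphs Literature.AnabelianGeometry.SemiGraphs.GaloisObjects
open Literature.AlgebraicGeometry.Frobenioids.QuasiTemperoid (stabilizerSubgroup)

universe u₀ v₀ w'

namespace ThetaFrobenioid

open ThetaSubquotient
open FrobenioidCyclotomicRigidity (ThetaSubquotientProjGalois)

section LevelN

variable {K : Type u₀} [Field K] {X : SemiGraphs.TemperedArithmeticGroup.{u₀} K} {D₀ : Type u₀} [Category.{v₀} D₀]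
  {V : FrdIMonoidStub.{max u₀ w'}} {T₀ : RealifiedDivisorMonoids (D₀ := D₀) V}
  {VD : FrdICatStub.{u₀ + 1, u₀, max u₀ w'} (ConnectedPart (BTemp X.Pi))}
  {tf : TemperedFrobenioid T₀ (ConnectedPart (BTemp X.Pi)) VD} {hZ : tf.monoidType = MonoidType.Z}
  {hP : ∀ A : (ConnectedPart (BTemp X.Pi))ᵒᵖ, IsPerfect (tf.Φ.carrier A)}
  {NH : Subgroup (Field.absoluteGaloisGroup K) → tf.category → ℕ+ → Prop} {A₀ : tf.category}
  {hA₀ : PreFrobenioid.IsFrobeniusTrivial tf.toElem A₀} {hA₀' : SemiGraphs.IsGaloisObj A₀.base.obj}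
  {lv N : ℕ+} {l' : ℕ} {RD : RigidData.{max u₀ w'} N l'}
  {pullFrac : ∀ {A A' : (BiKummerSetting.mkOfConnectedTemperoid X tf hZ hP NH A₀ hA₀ hA₀').C} (_ : A' ⟶ A),
    (BiKummerSetting.mkOfConnectedTemperoid X tf hZ hP NH A₀ hA₀ hA₀').biratUnits A →
      (BiKummerSetting.mkOfConnectedTemperoid X tf hZ hP NH A₀ hA₀ hA₀').biratUnits A'}
  {θ : (BiKummerSetting.mkOfConnectedTemperoid X tf hZ hP NH A₀ hA₀ hA₀').biratUnits
    (BiKummerSetting.mkOfConnectedTemperoid X tf hZ hP NH A₀ hA₀ hA₀').Aodot}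
  {Bl : (BiKummerSetting.mkOfConnectedTemperoid X tf hZ hP NH A₀ hA₀ hA₀').C}
  {Pl : (BiKummerSetting.mkOfConnectedTemperoid X tf hZ hP NH A₀ hA₀ hA₀').FractionPair θ Bl}
  {Rl : (BiKummerSetting.mkOfConnectedTemperoid X tf hZ hP NH A₀ hA₀ hA₀').NthRoot θ Pl lv pullFrac}
  (h : ModelFrobenioid.Hypotheses tf.divisorMonoid tf.ratFnFunctor)
  (odd_l : Odd (lv : ℕ))
  (R : (BiKummerSetting.mkOfConnectedTemperoid X tf hZ hP NH A₀ hA₀ hA₀').NthRoot Rl.root Rl.pair N pullFrac)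
  (ιX : RD.PiX ≃ₜ* X.Pi) (K' : Type (max u₀ w')) [Field K'] (constEmb : K'ˣ →* tf.biratUnitsModel R.BN)
  (constEmb_injective : Function.Injective constEmb)
  (hinvc : ∀ g : Aut R.AN.base,
    pull tf.divisorMonoid g.hom (ModelFrobenioid.div R.pair.num) = ModelFrobenioid.div R.pair.num)
  (hinvp : ∀ y : RD.PiX, y ∈ RD.PiYdd →
    pull tf.divisorMonoid ((BiKummerSetting.mkOfConnectedTemperoid X tf hZ hP NH A₀ hA₀ hA₀').galoisSurj R.AN.base
      R.αData.isGalois (ιX y)).hom (ModelFrobenioid.div R.pair.den) = ModelFrobenioid.div R.pair.den)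
  [RD.iotaN.range.Normal]

/-- **A PINNED v2 term at the level-`N` data** `ofConnectedTemperoidData h (RD.levelStub ιX) …`: `pre F := (autPre q_N ι_N F.obj).comap (mapAut F ι)`,
`proj F := autProj q_N ι_N F.obj ∘ mapAut` at every object `F` of `B^temp(Π)⁰`, onto at Galois objects (`autProj_surjective_at_galoisObj`,
`qN_surjective`) — abc-iut-w6-d079's construction (p486065) at `(q, ι) := (q_N, ι_N)`; the two pins `hPpre` / `hPproj_pin` of the `(Q, P)`-binder
kits hold BY CONSTRUCTION.  [cite: MochizukiEtTh2009, §5 p.327 (PDF p.101)] -/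
theorem exists_thetaSubquotientProjGalois_pinned_levelStub :
    ∃ P : ThetaSubquotientProjGalois (ofConnectedTemperoidData h (RD.levelStub ιX) odd_l R ιX K' constEmb constEmb_injective hinvc hinvp) fun E => IsGaloisObj E.obj,
      (∀ F : ConnectedPart (BTemp X.Pi),
          P.pre F = (autPre (RD.qN ιX) RD.iotaN F.obj).comap (Functor.mapAut F (connectedObjects (BTemp X.Pi)).ι)) ∧
        ∀ (F : ConnectedPart (BTemp X.Pi)) (σ : P.pre F) (τ : autPre (RD.qN ιX) RD.iotaN F.obj),
          Functor.mapAut F (connectedObjects (BTemp X.Pi)).ι σ.1 = τ.1 →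
            (P.proj F σ : LDelta (RD.qN ιX) RD.iotaN F.obj) = autProj (RD.qN ιX) RD.iotaN F.obj τ := by
  let ι' := (connectedObjects (BTemp X.Pi)).ι
  let pre : ∀ F : ConnectedPart (BTemp X.Pi), Subgroup (Aut F) := fun F =>
    (autPre (RD.qN ιX) RD.iotaN F.obj).comap (Functor.mapAut F ι')
  refine ⟨{ pre := pre
            proj := fun F => (autProj (RD.qN ιX) RD.iotaN F.obj).comp
              (((Functor.mapAut F ι').restrict (pre F)).codRestrict (autPre (RD.qN ιX) RD.iotaN F.obj) fun σ => σ.2)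
            proj_surjective := fun F hF c => ?_ }, fun F => rfl, fun F σ τ hστ => ?_⟩
  · obtain ⟨σ₀, hσ₀⟩ := autProj_surjective_at_galoisObj (RD.qN ιX) RD.iotaN hF (RD.qN_surjective ιX) c
    let eF : Aut F ≃* Aut F.obj := (connectedObjects (BTemp X.Pi)).fullyFaithfulι.autMulEquivOfFullyFaithful F
    have hmem : eF.symm σ₀.1 ∈ pre F := by
      change (Functor.mapAut F ι') (eF.symm σ₀.1) ∈ autPre (RD.qN ιX) RD.iotaN F.obj
      have : (Functor.mapAut F ι') (eF.symm σ₀.1) = eF (eF.symm σ₀.1) := rfl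
      rw [this, MulEquiv.apply_symm_apply]
      exact σ₀.2
    refine ⟨⟨eF.symm σ₀.1, hmem⟩, ?_⟩
    rw [← hσ₀]
    change autProj (RD.qN ιX) RD.iotaN F.obj ⟨eF (eF.symm σ₀.1), _⟩ = autProj (RD.qN ιX) RD.iotaN F.obj σ₀
    congr 1
  · change autProj (RD.qN ιX) RD.iotaN F.obj ⟨Functor.mapAut F ι' σ.1, _⟩ = autProj (RD.qN ιX) RD.iotaN F.obj τ
    congr 1
    exact Subtype.ext hστ

/-- **At the level-`N` data there is a v2 term satisfying the pin `hPpre` at `B_N^bs` AND the coverage input `LDeltaCovered`** of Prop. 5.5 /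
Thm. 5.6 (i) / Thm. 5.7 (C) — the pinned term of `exists_thetaSubquotientProjGalois_pinned_levelStub` (both pins) fed to my
`lDeltaCovered_levelStub_of_pins_galois` (p487842; abc-iut-L2-t9's p460877 on the v2 record): no further hypothesis.
[cite: MochizukiEtTh2009, Prop 5.5 proof p.327–328 (PDF pp.101–102); §1 p.238 (PDF p.12)] -/
theorem exists_thetaSubquotientProjGalois_pinned_lDeltaCoveredGal_levelStub :
    ∃ P : ThetaSubquotientProjGalois (ofConnectedTemperoidData h (RD.levelStub ιX) odd_l R ιX K' constEmb constEmb_injective hinvc hinvp)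
        fun E => IsGaloisObj E.obj,
      P.pre R.BN.base = (autPre (RD.qN ιX) RD.iotaN R.BN.base.obj).comap
          (Functor.mapAut R.BN.base (connectedObjects (BTemp X.Pi)).ι) ∧
        Thm56Sub.LDeltaCoveredGal (ofConnectedTemperoidData h (RD.levelStub ιX) odd_l R ιX K' constEmb constEmb_injective hinvc hinvp) P := by
  obtain ⟨P, hpre, hproj⟩ := exists_thetaSubquotientProjGalois_pinned_levelStub.{u₀, v₀, w'} h odd_l R ιX K' constEmb constEmb_injective
    hinvc hinvp
  -- elaborate the level-`N` piece with a closed type first (abc-iut-L2-t9's device), then assemble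
  have hcov := lDeltaCovered_levelStub_of_pins_galois.{u₀, v₀, w'} h odd_l R ιX K' constEmb constEmb_injective hinvc hinvp P
    (hpre R.BN.base) (hproj R.BN.base)
  exact ⟨P, hpre R.BN.base, hcov⟩

/-- The same term also satisfies the (C)-junction's **hlift law** — «every `ρ k ∈ P.pre (B_N^bs)`, `k ∈ Π^tp_Ÿ`, has a representative
`k₁ ∈ Π^tp_Ÿ ∩ l·Δ_Θ` with `ρ k₁ = ρ k`» (`hlift_levelStub_of_pin_galois`, p486982) — under abc-iut-w4-d042's `hH` («`ιX⁻¹(Stab x) ≤ Π^tp_Ÿ`»;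
a theorem for `A_⊙^bs := Ÿ`, `stabilizer_base_comap_le_PiYdd`).  So at the level-`N` data the (C)-junction heads `psiAut_symm_eq_of_rigidity_galois` /
`kummerComparison_of_thetaSectionCompat_of_rigidity_galois` (p486760) have their `P`, `hcov` and hlift inputs WITNESSED together; the Prop. 5.2 (iii)
pin, `IsKummerDetermined`, T56-L09c, (K4β) and the shadow law remain displayed.  [cite: MochizukiEtTh2009, §5 p.330 (PDF p.104)] -/
theorem exists_thetaSubquotientProjGalois_pinned_hlift_levelStub
    (hH : (stabilizerSubgroup R.BN.base.obj ((BiKummerSetting.NthRoot.baseIso _ R).hom.hom.hom.hom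
        (galoisBase X.isTempered R.AN.base.obj R.αData.isGalois))).comap ιX.toMonoidHom ≤ RD.PiYdd) :
    ∃ P : ThetaSubquotientProjGalois (ofConnectedTemperoidData h (RD.levelStub ιX) odd_l R ιX K' constEmb constEmb_injective hinvc hinvp)
        fun E => IsGaloisObj E.obj,
      P.pre R.BN.base = (autPre (RD.qN ιX) RD.iotaN R.BN.base.obj).comap
          (Functor.mapAut R.BN.base (connectedObjects (BTemp X.Pi)).ι) ∧
        Thm56Sub.LDeltaCoveredGal (ofConnectedTemperoidData h (RD.levelStub ιX) odd_l R ιX K' constEmb constEmb_injective hinvc hinvp) P ∧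
        ∀ (k : RD.PiYdd), rhoOfBiKummerData R ιX k ∈ P.pre R.BN.base →
          ∃ k₁ : RD.PiYdd, ((MulEquiv.refl RD.PiX) k₁ : RD.PiX) ∈ RD.lDeltaTheta ∧
            rhoOfBiKummerData R ιX k₁ = rhoOfBiKummerData R ιX k := by
  obtain ⟨P, hpre, hproj⟩ := exists_thetaSubquotientProjGalois_pinned_levelStub.{u₀, v₀, w'} h odd_l R ιX K' constEmb constEmb_injective
    hinvc hinvp
  have hcov := lDeltaCovered_levelStub_of_pins_galois.{u₀, v₀, w'} h odd_l R ιX K' constEmb constEmb_injective hinvc hinvp P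
    (hpre R.BN.base) (hproj R.BN.base)
  have hlift := hlift_levelStub_of_pin_galois.{u₀, v₀, w'} h odd_l R ιX K' constEmb constEmb_injective hinvc hinvp P (hpre R.BN.base) hH
  exact ⟨P, hpre R.BN.base, hcov, hlift⟩

end LevelN

end ThetaFrobenioid

end Literature.AnabelianGeometry.EtaleTheta

end
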